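import Literature.ModelTheory.Zilber.EACDensityLineTwist
import HarnessLib

/-!
# Real irrational slopes (1/3): the accumulation criterion and level points

Zilber's Exponential-Algebraic Closedness, case ladder (host summit Schanuel, cell `pub-schanuel`,
seat 2, gen 7).  First of three files deciding the last open row of the LINE family of
Mantova–Masser's density question (`EACDensityLineTwist`, module docstring: base `x₁ = a x₀ + b`
with `a ∈ ℝ \ ℚ`, fibre `y₀ = q(y₁)` with `q` not a monomial).  See
`ZilberEacRealLineDensity` for the theorem and the method.

**HONEST FRAMING.** Instances of an OPEN QUESTION (Mantova–Masser, Proc. LMS 2024, §1 p. 5);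
nothing here bears on Schanuel's conjecture (EAC ⇏ SC); `ECCell 3 2` stays OPEN.

Contents:
* `unprojectedDense_graphPolySurface_of_accumulation` — DENSITY CRITERION: if the fibre
  coordinates `w` of exponential points of `S = {x₁ = p(x₀), y₀ = q(y₁)}` (with `|z| → ∞`)
  accumulate at every point of an infinite set, the exponential points are Zariski dense
  (`EACDensityOscillatory.tendsto_norm_leadingCoeff_eval`: the leading `z`-coefficient of the
  pull-back of a vanishing polynomial dies along each sequence).
* `exists_levelPoint` — for irrational `a`, `b ∈ ℂ` and `q` with `q(0) ≠ 0` there is `u₀ ≠ 0`,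
  `q(u₀) ≠ 0`, on the level set `log |u| = a log |q(u)| + Re b` (intermediate values along the
  segment to a root of minimal modulus, `a > 0`, or the ray beyond a root of maximal modulus,
  `a < 0`; explicit for constant `q`).
-/

noncomputable section

open MvPolynomial Filter Topology Complex Metric
open Literature.NumberTheory.Transcendental Literature.ModelTheory.Zilber
  Literature.ModelTheory.ExponentialFields

set_option linter.dupNamespace false

namespace Summit.Schanuel.Schanuel.Theorems

/-! ## Part A. Density from a continuum of fibre accumulation values -/

section Criterion

/-- **Density criterion (accumulating fibres).** Let `S = {x₁ = p(x₀), y₀ = q(y₁)}`.  Suppose there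
is an INFINITE set `A ⊆ ℂ` such that every `α ∈ A` is the limit of the fibre coordinates `w_k` of a
sequence of exponential points `(z_k, p(z_k), q(w_k), w_k)` of `S` with `|z_k| → ∞`.  Then the
exponential points of `S` are Zariski dense, `I(S ∩ Γ_exp) = I(S)`: the leading `z`-coefficient
of the
pull-back of a vanishing polynomial dies along each sequence, hence vanishes on the infinite set
`A`. -/
theorem unprojectedDense_graphPolySurface_of_accumulation (p q : Polynomial ℂ) {A : Set ℂ}
    (hA : A.Infinite)
    (h : ∀ α ∈ A, ∃ z w : ℕ → ℂ, Tendsto (fun k => ‖z k‖) atTop atTop ∧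
      Tendsto w atTop (𝓝 α) ∧ ∀ k, exp (z k) = q.eval (w k) ∧ exp (p.eval (z k)) = w k) :
    UnprojectedDense (graphPolySurface p q) := by
  refine le_antisymm ?_ (vanishingIdeal_anti_mono Set.inter_subset_left)
  intro F hF
  have hG0 : gpPullbackT p q F = 0 := by
    by_contra hG
    have hlc : (gpPullbackT p q F).leadingCoeff ≠ 0 := Polynomial.leadingCoeff_ne_zero.mpr hG
    refine hA ((Polynomial.finite_setOf_isRoot hlc).subset fun α hα => ?_)
    obtain ⟨z, w, hz, hw, hzw⟩ := h α hα
    obtain ⟨B, hB⟩ := isBounded_iff_forall_norm_le.1 (isBounded_range_of_tendsto w hw)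
    have hGk : ∀ k, (gpPullbackT p q F).eval₂ (Polynomial.evalRingHom (w k)) (z k) = 0 := by
      intro k
      rw [← mmEval_eq_eval₂, mmEval_gpPullbackT]
      exact eval_eq_zero_of_mem_vanishingIdeal hF
        ⟨gpParam_mem p q _ _, gpParam_mem_expGraph p q (hzw k).1 (hzw k).2⟩
    have h1 := tendsto_norm_leadingCoeff_eval (gpPullbackT p q F) z w hz
      (fun k => hB _ ⟨k, rfl⟩) hGk
    have h2 : Tendsto (fun k => ‖(gpPullbackT p q F).leadingCoeff.eval (w k)‖) atTop
        (𝓝 ‖(gpPullbackT p q F).leadingCoeff.eval α‖) :=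
      (((gpPullbackT p q F).leadingCoeff.continuous.tendsto α).comp hw).norm
    have h3 := tendsto_nhds_unique h2 h1
    rw [norm_eq_zero] at h3
    exact h3
  refine mem_vanishingIdeal_of_eval fun s hs => ?_
  have h := mmEval_gpPullbackT p q F (s (Sum.inl 0)) (s (Sum.inr 1))
  rw [hG0, map_zero, ← eq_gpParam_of_mem p q hs] at h
  exact h.symm

end Criterion

/-! ## Part D. A point on the level set `log |u| = a log |q(u)| + Re b` -/

section LevelPoint

/-- Constant fibre polynomial: an explicit point on the level set. -/
theorem exists_levelPoint_C (a : ℝ) (b : ℂ) {c : ℂ} (hc : c ≠ 0) :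
    ∃ u₀ : ℂ, u₀ ≠ 0 ∧ (Polynomial.C c).eval u₀ ≠ 0 ∧
      Real.log ‖u₀‖ = a * Real.log ‖(Polynomial.C c).eval u₀‖ + b.re := by
  refine ⟨(Real.exp (a * Real.log ‖c‖ + b.re) : ℂ), ?_, ?_, ?_⟩
  · exact_mod_cast (Real.exp_pos _).ne'
  · rwa [Polynomial.eval_C]
  · rw [Polynomial.eval_C, norm_real, Real.norm_eq_abs, abs_of_pos (Real.exp_pos _), Real.log_exp]

/-- The real function `H(t) = a log |q(tρ)| + Re b - log |tρ|` is continuous at every `t` with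
`t ρ ≠ 0` and `q(tρ) ≠ 0`. -/
theorem continuousAt_levelFun (a : ℝ) (b : ℂ) (q : Polynomial ℂ) (ρ : ℂ) {t : ℝ}
    (h0 : (t : ℂ) * ρ ≠ 0) (hq : q.eval ((t : ℂ) * ρ) ≠ 0) :
    ContinuousAt (fun s : ℝ => a * Real.log ‖q.eval ((s : ℂ) * ρ)‖ + b.re -
      Real.log ‖(s : ℂ) * ρ‖) t := by
  have hc : Continuous fun s : ℝ => (s : ℂ) * ρ := continuous_ofReal.mul continuous_const
  have h1 : ContinuousAt (fun s : ℝ => Real.log ‖q.eval ((s : ℂ) * ρ)‖) t :=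
    ((q.continuous.comp hc).continuousAt.norm).log (norm_ne_zero_iff.2 hq)
  have h2 : ContinuousAt (fun s : ℝ => Real.log ‖(s : ℂ) * ρ‖) t :=
    (hc.continuousAt.norm).log (norm_ne_zero_iff.2 h0)
  exact ((continuousAt_const.mul h1).add continuousAt_const).sub h2

/-- **Level point, `a > 0`** (`q(0) ≠ 0`, `ρ` a root of `q` of minimal modulus): along the segment
`t ↦ tρ`, `t ∈ (0, 1)`, the function `H` tends to `+∞` at `0⁺` and to `-∞` at `1⁻`. -/
theorem exists_levelPoint_of_pos {a : ℝ} (ha : 0 < a) (b : ℂ) {q : Polynomial ℂ}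
    (hq0 : q.eval 0 ≠ 0) {ρ : ℂ} (hρ : q.IsRoot ρ) (hmin : ∀ ρ', q.IsRoot ρ' → ‖ρ‖ ≤ ‖ρ'‖) :
    ∃ u₀ : ℂ, u₀ ≠ 0 ∧ q.eval u₀ ≠ 0 ∧ Real.log ‖u₀‖ = a * Real.log ‖q.eval u₀‖ + b.re := by
  have hρ0 : ρ ≠ 0 := by
    rintro rfl
    exact hq0 hρ
  have hρn : 0 < ‖ρ‖ := norm_pos_iff.2 hρ0
  set H : ℝ → ℝ := fun s => a * Real.log ‖q.eval ((s : ℂ) * ρ)‖ + b.re -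
    Real.log ‖(s : ℂ) * ρ‖ with hH
  -- no roots on the open segment
  have hnz : ∀ t ∈ Set.Ioo (0 : ℝ) 1, q.eval ((t : ℂ) * ρ) ≠ 0 := by
    intro t ht h0
    have h1 := hmin _ h0
    rw [norm_mul, norm_real, Real.norm_eq_abs, abs_of_pos ht.1] at h1
    nlinarith [ht.2]
  have ht0 : ∀ t ∈ Set.Ioo (0 : ℝ) 1, (t : ℂ) * ρ ≠ 0 := fun t ht =>
    mul_ne_zero (by exact_mod_cast ht.1.ne') hρ0
  have hc : Continuous fun s : ℝ => (s : ℂ) * ρ := continuous_ofReal.mul continuous_const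
  -- behaviour at `0⁺`: `H → +∞`
  have hlim0 : Tendsto H (𝓝[>] 0) atTop := by
    have hG : Tendsto (fun s : ℝ => a * Real.log ‖q.eval ((s : ℂ) * ρ)‖ + b.re - Real.log ‖ρ‖)
        (𝓝[>] 0) (𝓝 (a * Real.log ‖q.eval ((0 : ℝ) * ρ)‖ + b.re - Real.log ‖ρ‖)) := by
      refine ContinuousAt.continuousWithinAt ?_
      have hq00 : q.eval (((0 : ℝ) : ℂ) * ρ) ≠ 0 := by simpa using hq0
      have h1 : ContinuousAt (fun s : ℝ => Real.log ‖q.eval ((s : ℂ) * ρ)‖) 0 :=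
        ((q.continuous.comp hc).continuousAt.norm).log (norm_ne_zero_iff.2 hq00)
      exact ((continuousAt_const.mul h1).add continuousAt_const).sub continuousAt_const
    have hlog : Tendsto (fun s : ℝ => -Real.log s) (𝓝[>] 0) atTop :=
      tendsto_neg_atBot_atTop.comp Real.tendsto_log_nhdsGT_zero
    refine (hG.add_atTop hlog).congr' ?_
    filter_upwards [self_mem_nhdsWithin] with s (hs : 0 < s)
    simp only [hH]
    rw [norm_mul, norm_real, Real.norm_eq_abs, abs_of_pos hs,
      Real.log_mul hs.ne' hρn.ne']
    ring
  -- behaviour at `1⁻`: `H → -∞`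
  have hlim1 : Tendsto H (𝓝[<] 1) atBot := by
    have hq1 : Tendsto (fun s : ℝ => ‖q.eval ((s : ℂ) * ρ)‖) (𝓝[<] 1) (𝓝[>] 0) := by
      refine tendsto_nhdsWithin_iff.2 ⟨?_, ?_⟩
      · have h1 : ‖q.eval (((1 : ℝ) : ℂ) * ρ)‖ = 0 := by simpa using hρ
        rw [← h1]
        exact ((q.continuous.comp hc).norm).continuousAt.continuousWithinAt
      · filter_upwards [Ioo_mem_nhdsLT zero_lt_one] with s hs
        exact norm_pos_iff.2 (hnz s hs)
    have hlog : Tendsto (fun s : ℝ => a * Real.log ‖q.eval ((s : ℂ) * ρ)‖) (𝓝[<] 1) atBot :=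
      (Real.tendsto_log_nhdsGT_zero.comp hq1).const_mul_atBot ha
    have hG : Tendsto (fun s : ℝ => b.re - Real.log ‖(s : ℂ) * ρ‖) (𝓝[<] 1)
        (𝓝 (b.re - Real.log ‖((1 : ℝ) : ℂ) * ρ‖)) := by
      refine ContinuousAt.continuousWithinAt (continuousAt_const.sub ?_)
      refine (hc.continuousAt.norm).log ?_
      simpa using hρ0
    refine (hlog.atBot_add hG).congr' (Eventually.of_forall fun s => ?_)
    simp only [hH]
    ring
  -- two points with opposite signs
  obtain ⟨t₁, ht₁H, ht₁⟩ := ((hlim0.eventually_gt_atTop 0).and (Ioo_mem_nhdsGT one_pos)).exists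
  obtain ⟨t₂, ht₂H, ht₂⟩ := ((hlim1.eventually_lt_atBot 0).and (Ioo_mem_nhdsLT ht₁.2)).exists
  have hI : ∀ t ∈ Set.Icc t₁ t₂, t ∈ Set.Ioo (0 : ℝ) 1 := fun t ht =>
    ⟨ht₁.1.trans_le ht.1, ht.2.trans_lt ht₂.2⟩
  have hcont : ContinuousOn H (Set.Icc t₁ t₂) := fun t ht =>
    (continuousAt_levelFun a b q ρ (ht0 t (hI t ht)) (hnz t (hI t ht))).continuousWithinAt
  obtain ⟨t, ht, hHt⟩ := intermediate_value_Icc' ht₂.1.le hcont ⟨ht₂H.le, ht₁H.le⟩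
  refine ⟨(t : ℂ) * ρ, ht0 t (hI t ht), hnz t (hI t ht), ?_⟩
  simp only [hH] at hHt
  linarith

/-- **Level point, `a < 0`** (`ρ ≠ 0` a root of `q` of maximal modulus): along the ray `t ↦ tρ`,
`t > 1`, `H → +∞` at `1⁺` and `H → -∞` at `+∞` (there `|q(tρ)| ≥ 1` eventually, so
`H ≤ Re b - log |tρ|`). -/
theorem exists_levelPoint_of_neg {a : ℝ} (ha : a < 0) (b : ℂ) {q : Polynomial ℂ} (hq : q ≠ 0)
    {ρ : ℂ} (hρ : q.IsRoot ρ) (hρ0 : ρ ≠ 0) (hmax : ∀ ρ', q.IsRoot ρ' → ‖ρ'‖ ≤ ‖ρ‖) :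
    ∃ u₀ : ℂ, u₀ ≠ 0 ∧ q.eval u₀ ≠ 0 ∧ Real.log ‖u₀‖ = a * Real.log ‖q.eval u₀‖ + b.re := by
  have hρn : 0 < ‖ρ‖ := norm_pos_iff.2 hρ0
  set H : ℝ → ℝ := fun s => a * Real.log ‖q.eval ((s : ℂ) * ρ)‖ + b.re -
    Real.log ‖(s : ℂ) * ρ‖ with hH
  have hnz : ∀ t : ℝ, 1 < t → q.eval ((t : ℂ) * ρ) ≠ 0 := by
    intro t ht h0
    have h1 := hmax _ h0
    rw [norm_mul, norm_real, Real.norm_eq_abs, abs_of_pos (one_pos.trans ht)] at h1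
    nlinarith
  have ht0 : ∀ t : ℝ, 1 < t → (t : ℂ) * ρ ≠ 0 := fun t ht =>
    mul_ne_zero (by exact_mod_cast (one_pos.trans ht).ne') hρ0
  have hc : Continuous fun s : ℝ => (s : ℂ) * ρ := continuous_ofReal.mul continuous_const
  -- behaviour at `1⁺`: `H → +∞`
  have hlim1 : Tendsto H (𝓝[>] 1) atTop := by
    have hq1 : Tendsto (fun s : ℝ => ‖q.eval ((s : ℂ) * ρ)‖) (𝓝[>] 1) (𝓝[>] 0) := by
      refine tendsto_nhdsWithin_iff.2 ⟨?_, ?_⟩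
      · have h1 : ‖q.eval (((1 : ℝ) : ℂ) * ρ)‖ = 0 := by simpa using hρ
        rw [← h1]
        exact ((q.continuous.comp hc).norm).continuousAt.continuousWithinAt
      · filter_upwards [self_mem_nhdsWithin] with s (hs : 1 < s)
        exact norm_pos_iff.2 (hnz s hs)
    have hlog : Tendsto (fun s : ℝ => a * Real.log ‖q.eval ((s : ℂ) * ρ)‖) (𝓝[>] 1) atTop :=
      (Real.tendsto_log_nhdsGT_zero.comp hq1).const_mul_atBot_of_neg ha
    have hG : Tendsto (fun s : ℝ => b.re - Real.log ‖(s : ℂ) * ρ‖) (𝓝[>] 1)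
        (𝓝 (b.re - Real.log ‖((1 : ℝ) : ℂ) * ρ‖)) := by
      refine ContinuousAt.continuousWithinAt (continuousAt_const.sub ?_)
      refine (hc.continuousAt.norm).log ?_
      simpa using hρ0
    refine (hlog.atTop_add hG).congr' (Eventually.of_forall fun s => ?_)
    simp only [hH]
    ring
  -- behaviour at `+∞`: eventually `H < 0`
  have hev : ∀ᶠ t : ℝ in atTop, H t < 0 := by
    have hdeg : 0 < q.degree := Polynomial.degree_pos_of_root hq hρ
    have hnorm : Tendsto (fun t : ℝ => ‖(t : ℂ) * ρ‖) atTop atTop := by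
      have h1 : (fun t : ℝ => ‖(t : ℂ) * ρ‖) = fun t => |t| * ‖ρ‖ := by
        funext t
        rw [norm_mul, norm_real, Real.norm_eq_abs]
      rw [h1]
      exact tendsto_abs_atTop_atTop.atTop_mul_const hρn
    have hqinf : Tendsto (fun t : ℝ => ‖q.eval ((t : ℂ) * ρ)‖) atTop atTop :=
      q.tendsto_norm_atTop hdeg hnorm
    have hlog : Tendsto (fun t : ℝ => b.re - Real.log ‖(t : ℂ) * ρ‖) atTop atBot :=
      tendsto_atBot_add_const_left _ _
        (tendsto_neg_atTop_atBot.comp (Real.tendsto_log_atTop.comp hnorm))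
    filter_upwards [hqinf.eventually_ge_atTop 1, hlog.eventually_lt_atBot 0] with t h1 h2
    have h3 : 0 ≤ Real.log ‖q.eval ((t : ℂ) * ρ)‖ := Real.log_nonneg h1
    have h4 : a * Real.log ‖q.eval ((t : ℂ) * ρ)‖ ≤ 0 := mul_nonpos_of_nonpos_of_nonneg ha.le h3
    simp only [hH]
    have h5 : b.re + -Real.log ‖(t : ℂ) * ρ‖ < 0 := by simpa [sub_eq_add_neg] using h2
    linarith
  obtain ⟨t₁, ht₁H, ht₁⟩ := ((hlim1.eventually_gt_atTop 0).and self_mem_nhdsWithin).exists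
  obtain ⟨t₂, ht₂H, ht₂⟩ := (hev.and (eventually_gt_atTop t₁)).exists
  have ht₁' : (1 : ℝ) < t₁ := ht₁
  have hI : ∀ t ∈ Set.Icc t₁ t₂, (1 : ℝ) < t := fun t ht => ht₁'.trans_le ht.1
  have hcont : ContinuousOn H (Set.Icc t₁ t₂) := fun t ht =>
    (continuousAt_levelFun a b q ρ (ht0 t (hI t ht)) (hnz t (hI t ht))).continuousWithinAt
  obtain ⟨t, ht, hHt⟩ := intermediate_value_Icc' ht₂.le hcont ⟨ht₂H.le, ht₁H.le⟩
  refine ⟨(t : ℂ) * ρ, ht0 t (hI t ht), hnz t (hI t ht), ?_⟩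
  simp only [hH] at hHt
  linarith

/-- **Existence of a level point** for irrational `a` and `q(0) ≠ 0`: either `q` is a nonzero
constant (explicit point), or `q` has a root (nonzero), and one argues along the segment to a
root of
minimal modulus (`a > 0`) or along the ray beyond a root of maximal modulus (`a < 0`). -/
theorem exists_levelPoint {a : ℝ} (ha : Irrational a) (b : ℂ) {q : Polynomial ℂ}
    (hq0 : q.eval 0 ≠ 0) :
    ∃ u₀ : ℂ, u₀ ≠ 0 ∧ q.eval u₀ ≠ 0 ∧ Real.log ‖u₀‖ = a * Real.log ‖q.eval u₀‖ + b.re := by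
  classical
  have hq : q ≠ 0 := by
    rintro rfl
    exact hq0 Polynomial.eval_zero
  by_cases hdeg : 0 < q.degree
  · obtain ⟨ρ₀, hρ₀⟩ := Complex.exists_root hdeg
    have hne : (q.roots.toFinset).Nonempty :=
      ⟨ρ₀, Multiset.mem_toFinset.2 ((Polynomial.mem_roots hq).2 hρ₀)⟩
    have hroot : ∀ ρ ∈ q.roots.toFinset, q.IsRoot ρ := fun ρ h =>
      (Polynomial.mem_roots hq).1 (Multiset.mem_toFinset.1 h)
    have hroot' : ∀ ρ, q.IsRoot ρ → ρ ∈ q.roots.toFinset := fun ρ h =>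
      Multiset.mem_toFinset.2 ((Polynomial.mem_roots hq).2 h)
    rcases lt_or_gt_of_ne ha.ne_zero with hneg | hpos
    · obtain ⟨ρ, hρ, hmax⟩ := Finset.exists_max_image q.roots.toFinset (fun z => ‖z‖) hne
      have hρ0 : ρ ≠ 0 := by
        rintro rfl
        exact hq0 (hroot 0 hρ)
      exact exists_levelPoint_of_neg hneg b hq (hroot ρ hρ) hρ0 fun ρ' h => hmax ρ' (hroot' ρ' h)
    · obtain ⟨ρ, hρ, hmin⟩ := Finset.exists_min_image q.roots.toFinset (fun z => ‖z‖) hne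
      exact exists_levelPoint_of_pos hpos b hq0 (hroot ρ hρ) fun ρ' h => hmin ρ' (hroot' ρ' h)
  · push Not at hdeg
    have hqC : q = Polynomial.C (q.eval 0) := by
      rw [Polynomial.eq_C_of_degree_le_zero hdeg]
      simp
    rw [hqC]
    exact exists_levelPoint_C a b (by rwa [hqC, Polynomial.eval_C] at hq0)

end LevelPoint

end Summit.Schanuel.Schanuel.Theorems

end
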